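import Mathlib.MeasureTheory.Measure.Haar.Basic
import Mathlib.MeasureTheory.Integral.Bochner.Basic
import Mathlib.MeasureTheory.Group.Integral
import Mathlib.Analysis.Convex.Integral
import Mathlib.Topology.MetricSpace.HausdorffDistance
import Mathlib.Topology.ContinuousMap.Compact
import Literature.RepresentationTheory.CompactGroups.PolynomialFunctionsUnitaryGroup
import Literature.RepresentationTheory.CompactGroups.ZariskiClosureUnitary
import Literature.RepresentationTheory.CompactGroups.UnitaryTrick
import Literature.MathematicalPhysics.QuantumLattice.GaugeGroups
import Literature.MathematicalPhysics.QuantumLattice.YangMillsClassical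
import HarnessLib

/-!
# Chevalley's theorem: a compact subgroup of `U(n)` is the set of unitary points of its Zariski closure

Topic `RepresentationTheory/CompactGroups`. **Compact linear groups are algebraic** (C. Chevalley,
*Theory of Lie Groups I* (1946), Ch. VI §§VIII–IX; A. L. Onishchik, E. B. Vinberg, *Lie Groups and
Algebraic Groups* (1990), Ch. 5 §2, Thm. 5): for a compact subgroup `H ≤ GL n ℂ` consisting of
unitary matrices, a unitary matrix annihilated by every polynomial (in the entries and `det⁻¹`)
vanishing on `H` already lies in `H` — `mem_of_mem_zariskiClosure_of_mem_unitaryGroup`,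
`mem_zariskiClosure_iff_of_mem_unitaryGroup` (Zariski closure in the sense of the tree's
`Literature.NumberTheory.Automorphic.zariskiClosure`). Together with the Zariski density of the
unitary points of a self-adjoint algebraic group (`UnitaryPointsZariskiDense`) this identifies the
Zariski closure of `H` with its complexification and is the bridge between compact Lie groups and
the tree's theory of linear algebraic groups (used for `ExistsAbelianCentralizer`).

Proof (Weyl–Chevalley). If `x ∉ H`, the right-`H`-invariant continuous function
`f₀ = dist(·, H)` (Frobenius distance; right multiplication by a unitary matrix is an isometry)
vanishes on `H` and is positive at `x`. Stone–Weierstrass gives a real polynomial `p` in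
`Re U_{ij}, Im U_{ij}` uniformly close to `f₀` on the compact `U(n)`
(`PolynomialFunctionsUnitaryGroup`); averaging `p` over `H` with Haar measure inside the
finite-dimensional translation-invariant space of polynomial functions of bounded degree
(`exists_invariant_average`) keeps it polynomial, makes it invariant and keeps it close to `f₀`;
subtracting its value at `1` gives a polynomial vanishing on `H` and positive at `x`, whose
complexification is a `GL n ℂ`-polynomial vanishing on `H` but not at `x`.

Everything is proved; no definitions. Mathlib: Stone–Weierstrass, Bochner integration in
`C(U(n), ℝ)`, `Convex.integral_mem`, Haar measure; the tree: unimodularity of compact groups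
(`UnitaryTrick`), compactness of `U(n)` (`GaugeGroups`), unitary invariance of the Frobenius norm
(`YangMillsClassical`).

## References

* C. Chevalley, *Theory of Lie Groups I*, Princeton Univ. Press (1946), Ch. VI §§VIII–IX.
* A. L. Onishchik, E. B. Vinberg, *Lie Groups and Algebraic Groups*, Springer (1990), Ch. 5 §2.
* T. Bröcker, T. tom Dieck, *Representations of Compact Lie Groups* (1985), III (4.1), II (1.7).
-/

noncomputable section

namespace Literature.RepresentationTheory.CompactGroups

open Literature.NumberTheory.Automorphic MeasureTheory
open scoped Matrix.Norms.Frobenius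

variable {n : Type*} [Fintype n] [DecidableEq n]



/-! ### Haar averaging inside a finite-dimensional invariant space of functions -/

/-- **Invariant averages.** Let `K ≤ U(n)` be a closed subgroup, `V` a finite-dimensional space of
continuous real functions on `U(n)` stable under the right translations `F ↦ F(· k)`, `k ∈ K`, and
`g ∈ V`. The Haar average `ḡ = ∫_K g(· k) dk` lies in `V` (a closed convex set), is right
`K`-invariant, and is at least as close as `g` to every right `K`-invariant function `f`
(`‖ḡ - f‖ ≤ ‖g - f‖`, the translations being isometries of `C(U(n), ℝ)`). (Weyl's averaging;
Bröcker–tom Dieck II (1.7); Onishchik–Vinberg Ch. 5 §2, proof of Thm. 5.) [folklore] -/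
theorem exists_invariant_average (K : Subgroup (Matrix.unitaryGroup n ℂ))
    (hK : IsClosed (K : Set (Matrix.unitaryGroup n ℂ)))
    (V : Submodule ℝ C(Matrix.unitaryGroup n ℂ, ℝ)) [FiniteDimensional ℝ V]
    (hV : ∀ k ∈ K, ∀ F ∈ V,
      F.comp ⟨fun U : Matrix.unitaryGroup n ℂ => U * k, continuous_mul_const k⟩ ∈ V)
    {g : C(Matrix.unitaryGroup n ℂ, ℝ)} (hg : g ∈ V) :
    ∃ gbar ∈ V,
      (∀ k ∈ K, gbar.comp ⟨fun U : Matrix.unitaryGroup n ℂ => U * k, continuous_mul_const k⟩ = gbar) ∧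
      ∀ f : C(Matrix.unitaryGroup n ℂ, ℝ),
        (∀ k ∈ K, f.comp ⟨fun U : Matrix.unitaryGroup n ℂ => U * k, continuous_mul_const k⟩ = f) →
          ‖gbar - f‖ ≤ ‖g - f‖ := by
  classical
  -- the compact group `K` and its Haar probability measure
  haveI : CompactSpace K := isCompact_iff_compactSpace.mp hK.isCompact
  letI : MeasurableSpace K := borel K
  haveI : BorelSpace K := ⟨rfl⟩
  set μ : Measure K := Measure.haarMeasure ⊤ with hμ
  haveI : IsProbabilityMeasure μ := CompactGroup.isProbabilityMeasure_haarMeasure_top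
  -- the orbit map `k ↦ g(· k)`
  let Φ : C(K, C(Matrix.unitaryGroup n ℂ, ℝ)) := ContinuousMap.curry
    ⟨fun p : K × Matrix.unitaryGroup n ℂ => g (p.2 * (p.1 : Matrix.unitaryGroup n ℂ)), by fun_prop⟩
  have hΦapply : ∀ (k : K) (U : Matrix.unitaryGroup n ℂ),
      Φ k U = g (U * (k : Matrix.unitaryGroup n ℂ)) := fun k U => rfl
  have hΦ : ∀ k : K, Φ k =
      g.comp ⟨fun U : Matrix.unitaryGroup n ℂ => U * (k : Matrix.unitaryGroup n ℂ),
        continuous_mul_const _⟩ := fun k => by ext U; rfl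
  have hint : Integrable Φ μ :=
    Φ.continuous.integrable_of_hasCompactSupport (HasCompactSupport.of_compactSpace Φ)
  refine ⟨∫ k, Φ k ∂μ, ?_, ?_, ?_⟩
  · -- membership in the closed convex set `V`
    exact Convex.integral_mem V.convex V.closed_of_finiteDimensional
      (ae_of_all μ fun k => by rw [hΦ]; exact hV _ k.2 g hg) hint
  · -- invariance
    intro k₀ hk₀
    let T : C(Matrix.unitaryGroup n ℂ, ℝ) →L[ℝ] C(Matrix.unitaryGroup n ℂ, ℝ) :=
      { toFun := fun F => F.comp ⟨fun U : Matrix.unitaryGroup n ℂ => U * k₀, continuous_mul_const k₀⟩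
        map_add' := fun _ _ => rfl
        map_smul' := fun _ _ => rfl
        cont := ContinuousMap.continuous_precomp _ }
    have hT : ∀ k : K, T (Φ k) = Φ (⟨k₀, hk₀⟩ * k) := fun k => by
      ext U
      change g (U * k₀ * (k : Matrix.unitaryGroup n ℂ)) = g (U * (k₀ * (k : Matrix.unitaryGroup n ℂ)))
      rw [mul_assoc]
    calc (∫ k, Φ k ∂μ).comp ⟨fun U : Matrix.unitaryGroup n ℂ => U * k₀, continuous_mul_const k₀⟩
        = T (∫ k, Φ k ∂μ) := rfl
      _ = ∫ k, T (Φ k) ∂μ := (T.integral_comp_comm hint).symm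
      _ = ∫ k, Φ (⟨k₀, hk₀⟩ * k) ∂μ := by simp_rw [hT]
      _ = ∫ k, Φ k ∂μ := integral_mul_left_eq_self (fun k => Φ k) _
  · -- norm bound
    intro f hf
    have hsub : (∫ k, Φ k ∂μ) - f = ∫ k, (Φ k - f) ∂μ := by
      rw [integral_sub hint (integrable_const f), integral_const]
      simp
    rw [hsub]
    have hbound : ∀ k : K, ‖Φ k - f‖ ≤ ‖g - f‖ := fun k => by
      have hcomp : Φ k - f = (g - f).comp
          ⟨fun U : Matrix.unitaryGroup n ℂ => U * (k : Matrix.unitaryGroup n ℂ),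
            continuous_mul_const _⟩ := by
        conv_lhs => rw [hΦ, ← hf _ k.2]
        rfl
      rw [hcomp, ContinuousMap.norm_le _ (norm_nonneg _)]
      exact fun U => (g - f).norm_coe_le_norm _
    calc ‖∫ k, (Φ k - f) ∂μ‖ ≤ ‖g - f‖ * μ.real Set.univ :=
          norm_integral_le_of_norm_le_const (ae_of_all μ hbound)
      _ = ‖g - f‖ := by simp

/-! ### Chevalley's theorem: compact matrix groups are algebraic -/

/-- **Chevalley's theorem: a compact subgroup of `U(n)` is the set of unitary points of its
Zariski closure** (compact linear groups are algebraic). Let `H ≤ GL n ℂ` be compact (Euclidean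
topology) with `H ⊆ U(n)`. If `x ∈ U(n)` lies in the Zariski closure of `H` (every polynomial in
the matrix entries and `det⁻¹` vanishing on `H` vanishes at `x`), then `x ∈ H`.

Proof. If `x ∉ H`, the continuous right-`H`-invariant function `f₀(U) = dist(U, H)` (Frobenius
distance, invariant because right multiplication by a unitary matrix is an isometry preserving `H`)
vanishes on `H` and is positive at `x`. By Stone–Weierstrass a real polynomial `p` in
`Re U_{ij}, Im U_{ij}` is within `ε = f₀(x)/3` of `f₀` on `U(n)`; its Haar average `p̄` over `H` is
again a polynomial of the same degree (`exists_invariant_average` in the finite-dimensional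
translation-invariant space of polynomial functions of bounded degree), right-`H`-invariant, and
still within `ε` of `f₀`; hence `q = p̄ - p̄(1)` vanishes on `H` and `q(x) ≥ ε > 0`. Its
complexification (`exists_glPoly_eval_eq_aeval`: `conj U_{ij} = (U⁻¹)_{ji}` on `U(n)`) is a
polynomial in the coordinates of `GL n ℂ` vanishing on `H` but not at `x` — a contradiction.
(Chevalley 1946, Ch. VI §IX; Onishchik–Vinberg 1990, Ch. 5 §2 Thm. 5.) [folklore] -/
theorem mem_of_mem_zariskiClosure_of_mem_unitaryGroup {H : Subgroup (GL n ℂ)}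
    (hHc : IsCompact (H : Set (GL n ℂ)))
    (hHU : ∀ h ∈ H, (h : Matrix n n ℂ) ∈ Matrix.unitaryGroup n ℂ)
    {x : GL n ℂ} (hx : x ∈ zariskiClosure H) (hxU : (x : Matrix n n ℂ) ∈ Matrix.unitaryGroup n ℂ) :
    x ∈ H := by
  classical
  by_contra hxH
  obtain ⟨gen, hre, him⟩ := exists_gen (n := n)
  -- `H` seen inside the compact group `U(n)`
  set K : Subgroup (Matrix.unitaryGroup n ℂ) := H.comap Unitary.toUnits with hKdef
  have hmemK : ∀ U : Matrix.unitaryGroup n ℂ, U ∈ K ↔ Unitary.toUnits U ∈ H := fun U => Iff.rfl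
  have htoU : ∀ U : Matrix.unitaryGroup n ℂ,
      ((Unitary.toUnits U : GL n ℂ) : Matrix n n ℂ) = (U : Matrix n n ℂ) := fun U => rfl
  have hcont : Continuous (Unitary.toUnits : Matrix.unitaryGroup n ℂ → GL n ℂ) := by
    refine Units.continuous_iff.2 ⟨?_, ?_⟩
    · exact continuous_subtype_val
    · change Continuous fun U : Matrix.unitaryGroup n ℂ => star (U : Matrix n n ℂ)
      exact continuous_subtype_val.star
  have hKclosed : IsClosed (K : Set (Matrix.unitaryGroup n ℂ)) := by
    have : (K : Set (Matrix.unitaryGroup n ℂ)) = Unitary.toUnits ⁻¹' (H : Set (GL n ℂ)) := rfl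
    rw [this]
    exact hHc.isClosed.preimage hcont
  -- the point `x` as an element of `U(n)`, outside `K`
  set x' : Matrix.unitaryGroup n ℂ := ⟨(x : Matrix n n ℂ), hxU⟩ with hx'def
  have hx'x : Unitary.toUnits x' = x := Units.ext rfl
  have hx'K : x' ∉ K := fun h => hxH (by rwa [hmemK, hx'x] at h)
  -- every `h ∈ H` comes from `K`
  have hHK : ∀ h ∈ H, ∃ k ∈ K, Unitary.toUnits k = h := fun h hh =>
    ⟨⟨(h : Matrix n n ℂ), hHU h hh⟩, by
      rw [hmemK]; convert hh; exact Units.ext rfl, Units.ext rfl⟩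
  -- the invariant separating function `f₀ = dist(·, H)`
  set HM : Set (Matrix n n ℂ) := (fun h : GL n ℂ => (h : Matrix n n ℂ)) '' (H : Set (GL n ℂ))
    with hHMdef
  have hHMc : IsClosed HM := (hHc.image Units.continuous_val).isClosed
  have hHMne : HM.Nonempty := ⟨1, ⟨1, H.one_mem, rfl⟩⟩
  have hxHM : (x : Matrix n n ℂ) ∉ HM := by
    rintro ⟨h, hh, hhx⟩
    exact hxH ((Units.ext hhx : h = x) ▸ hh)
  let f₀ : C(Matrix.unitaryGroup n ℂ, ℝ) :=
    ⟨fun U => Metric.infDist (U : Matrix n n ℂ) HM,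
      (Metric.continuous_infDist_pt HM).comp continuous_subtype_val⟩
  have hf₀apply : ∀ U : Matrix.unitaryGroup n ℂ, f₀ U = Metric.infDist (U : Matrix n n ℂ) HM :=
    fun U => rfl
  have hf₀K : ∀ k ∈ K, f₀ k = 0 := fun k hk => by
    rw [hf₀apply]
    exact Metric.infDist_zero_of_mem ⟨Unitary.toUnits k, hk, rfl⟩
  have hf₀x : 0 < f₀ x' := (hHMc.notMem_iff_infDist_pos hHMne).1 hxHM
  have hf₀inv : ∀ k ∈ K,
      f₀.comp ⟨fun U : Matrix.unitaryGroup n ℂ => U * k, continuous_mul_const k⟩ = f₀ := by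
    intro k hk
    ext U
    change Metric.infDist ((U : Matrix n n ℂ) * (k : Matrix n n ℂ)) HM =
      Metric.infDist (U : Matrix n n ℂ) HM
    have hiso : Isometry fun A : Matrix n n ℂ => A * (k : Matrix n n ℂ) :=
      Isometry.of_dist_eq fun A B => by
        rw [dist_eq_norm, dist_eq_norm, ← sub_mul, Matrix.frobenius_norm_mul_unitaryGroup]
    have himage : (fun A : Matrix n n ℂ => A * (k : Matrix n n ℂ)) '' HM = HM := by
      ext A
      constructor
      · rintro ⟨_, ⟨h, hh, rfl⟩, rfl⟩
        exact ⟨h * Unitary.toUnits k, H.mul_mem hh hk, rfl⟩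
      · rintro ⟨h, hh, rfl⟩
        refine ⟨(h * (Unitary.toUnits k)⁻¹ : GL n ℂ), ⟨_, H.mul_mem hh (H.inv_mem hk), rfl⟩, ?_⟩
        change ((h * (Unitary.toUnits k)⁻¹ : GL n ℂ) : Matrix n n ℂ) * (k : Matrix n n ℂ) = h
        rw [← htoU k, ← Units.val_mul, inv_mul_cancel_right]
    rw [← himage, Metric.infDist_image hiso, himage]
  -- Stone–Weierstrass: a polynomial function `ε`-close to `f₀`
  set ε : ℝ := f₀ x' / 3 with hεdef
  have hε : 0 < ε := by positivity
  obtain ⟨⟨g, hgA⟩, hg⟩ := ContinuousMap.exists_mem_subalgebra_near_continuousMap_of_separatesPoints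
    _ (subalgebra_aeval_range_separatesPoints gen hre him) f₀ ε hε
  obtain ⟨p, rfl⟩ := (AlgHom.mem_range _).1 hgA
  -- the finite-dimensional translation-invariant space of polynomial functions of degree ≤ d
  set d : ℕ := p.totalDegree with hddef
  set V : Submodule ℝ C(Matrix.unitaryGroup n ℂ, ℝ) :=
    Submodule.map (MvPolynomial.aeval (R := ℝ) gen).toLinearMap
      (MvPolynomial.restrictTotalDegree ((n × n) ⊕ (n × n)) ℝ d) with hVdef
  have hpV : MvPolynomial.aeval (R := ℝ) gen p ∈ V :=
    ⟨p, (MvPolynomial.mem_restrictTotalDegree _ _ _).2 le_rfl, rfl⟩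
  have hVinv : ∀ k ∈ K, ∀ F ∈ V,
      F.comp ⟨fun U : Matrix.unitaryGroup n ℂ => U * k, continuous_mul_const k⟩ ∈ V := by
    rintro k - F ⟨q, hq, rfl⟩
    exact comp_mulRight_mem_map_restrictTotalDegree gen hre him d k hq
  obtain ⟨gbar, hgbarV, hgbarinv, hgbarnorm⟩ := exists_invariant_average K hKclosed V hVinv hpV
  have hclose : ‖gbar - f₀‖ < ε := (hgbarnorm f₀ hf₀inv).trans_lt hg
  obtain ⟨P, -, hP⟩ := hgbarV
  have hPg : MvPolynomial.aeval (R := ℝ) gen P = gbar := hP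
  -- `q = P - P̄(1)` vanishes on `K` and is positive at `x'`
  set Q : MvPolynomial ((n × n) ⊕ (n × n)) ℝ := P - MvPolynomial.C (gbar 1) with hQdef
  have hQapply : ∀ U : Matrix.unitaryGroup n ℂ, MvPolynomial.aeval (R := ℝ) gen Q U = gbar U - gbar 1 := by
    intro U
    rw [hQdef, map_sub, hPg, MvPolynomial.algHom_C]
    rfl
  have hgbar1 : ∀ k ∈ K, gbar k = gbar 1 := fun k hk => by
    conv_lhs => rw [← one_mul k]
    conv_rhs => rw [← hgbarinv k hk]
    rfl
  have hQK : ∀ k ∈ K, MvPolynomial.aeval (R := ℝ) gen Q k = 0 := fun k hk => by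
    rw [hQapply, hgbar1 k hk, sub_self]
  have hQx : 0 < MvPolynomial.aeval (R := ℝ) gen Q x' := by
    rw [hQapply]
    have h1 : |gbar x' - f₀ x'| ≤ ‖gbar - f₀‖ := by
      rw [← Real.norm_eq_abs]; exact (gbar - f₀).norm_coe_le_norm x'
    have h2 : |gbar 1 - f₀ 1| ≤ ‖gbar - f₀‖ := by
      rw [← Real.norm_eq_abs]; exact (gbar - f₀).norm_coe_le_norm 1
    rw [hf₀K 1 K.one_mem, sub_zero] at h2
    have h3 := abs_le.1 h1
    have h4 := abs_le.1 h2
    linarith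
  -- complexify `Q` and evaluate the resulting `GL n ℂ`-polynomial
  obtain ⟨Qc, hQc⟩ := exists_glPoly_eval_eq_aeval gen hre him Q
  have hHZ : (H : Set (GL n ℂ)) ⊆ zeroLocusGL {Qc} := by
    intro h hh p hp
    rw [Set.mem_singleton_iff.1 hp]
    obtain ⟨k, hk, rfl⟩ := hHK h hh
    rw [hQc, hQK k hk, Complex.ofReal_zero]
  have h0 : MvPolynomial.eval (glCoordFun x) Qc = 0 :=
    eval_eq_zero_of_mem_zariskiClosure (fun h hh => hHZ hh Qc rfl) hx
  rw [← hx'x, hQc, Complex.ofReal_eq_zero] at h0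
  exact hQx.ne' h0

/-- Chevalley's theorem, intersection form: for a compact `H ≤ GL n ℂ` contained in `U(n)`, an
element of `U(n)` lies in `H` iff it lies in the Zariski closure of `H`. [folklore] -/
theorem mem_zariskiClosure_iff_of_mem_unitaryGroup {H : Subgroup (GL n ℂ)}
    (hHc : IsCompact (H : Set (GL n ℂ)))
    (hHU : ∀ h ∈ H, (h : Matrix n n ℂ) ∈ Matrix.unitaryGroup n ℂ)
    {x : GL n ℂ} (hxU : (x : Matrix n n ℂ) ∈ Matrix.unitaryGroup n ℂ) :
    x ∈ zariskiClosure H ↔ x ∈ H :=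
  ⟨fun hx => mem_of_mem_zariskiClosure_of_mem_unitaryGroup hHc hHU hx hxU,
    fun hx => le_zariskiClosure H hx⟩

end Literature.RepresentationTheory.CompactGroups

end
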